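import Literature.MathematicalPhysics.QuantumFieldTheory.Balaban1983to89.Node00.OpsYSectEElim
import Literature.MathematicalPhysics.QuantumFieldTheory.Balaban1983to89.B9Eq3104CommutatorSizesAvg
import Literature.MathematicalPhysics.QuantumFieldTheory.Balaban1983to89.B9Thm314WholePinGeometry
import HarnessLib

/-!
# `Balaban1983to89.B1Eq324BenfattoClassSectEMemberJRowScaleAtNode00` — THE UNITS OF THE `𝒥`-ROW OF THE (3.24) PRECISION DOOR AT NODE 00's FLAT
# LETTERS: the weight operator `a` of T. Bałaban, *Propagators for lattice gauge theories in a background field*, Commun. Math. Phys. **99** (1985)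
# 389–434 [Balaban1985BackgroundPropagators], (3.26) p. 395 ∕ (3.156) p. 428, against the band (2.16) of *Propagators and renormalization
# transformations for lattice gauge theories. II*, Commun. Math. Phys. **96** (1984) 223–250 [Balaban1984PropagatorsII]

statement-level companion of published sources with citation tags; every declaration here is a theorem; nothing here is a claim about the
Yang–Mills mass gap

WHY THIS MODULE (cell `pub-ymgap`, seat `dag-n08-d` gen 31, CHECK-J ∕ INTENT-86; node N08 [Balaban1985UV3], the (α)-row `h324` behind [Balaban1985UV3] (3.24)).
The (3.24) PRECISION DOORS at NODE 00's named letters (seat n08-b's `…CoReadProduct.eq324_CsDeltaCY_precision_node00_on_unit`, `…RealAdjointAtNode00` §6–§8)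
state [Balaban1982Higgs1] (3.24) for the Gaussian `𝒩(0, 𝕄_Λ̃(C*Δ_kC)⁻¹)` of [Balaban1985BackgroundPropagators] (3.155)–(3.158) with CLASS SCALARS
`γ₀, B_P, K_J, δ` bound FIRST and the member `x : MemberY …` bound AFTER them, and display among their hypotheses the `𝒥`-ROW (R2′b)
* `hJ : ∀ u v E, ‖((a + ⟨D̃⁽²⁾·,J⟩(U))(δ_v ⊗ E))(u)‖ ≤ K_J·‖E‖·e^{−δ|y_u − y_v|}`   (`a = aY x.toKIdx`, `⟨D̃⁽²⁾·,J⟩(U) = 𝔢.D2J U`, `|y − y′| = unitDistY`).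
The letters are def-Y's FLAT letters.  def-Y's CONVENTION WORD (v) (`Node00.OpsYSectELetters`, module docstring) records their units: *«`deltaKY =
diag(L^{jD}) ∘ Δ_k` of print, i.e. `η^{−D}×` the flat matrix of the quadratic form (3.156) (`⟨B,(QG₁Q*)⁻¹B⟩_𝔅 = η^{D}·Bᵀ(QG1QinvY U)B`, `a⟨B,B⟩_𝔅 =
η^{D}·Bᵀ(aY)B`) … `aY` = print's `a` in the same flat-form convention BECAUSE r06's band `B6CubeWindowV1.GlobalBand` puts the measure factor into the
weights (`i.w ∈ [b₀,b₁]·L^{jD}·(c_f/L^j)²`)»* (`D = d + 1`, `L = ℓ + 1`, `η = L^{−k}`).  THIS FILE turns that word into theorems about the `𝒥`-row: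
* §1 `a` on one-bond functions: `a(δ_v ⊗ E)(u) = [u = v]·w_u·E` (n06's `aY_apply` + def-Y's `aK_eq_diagonal`), `‖a(δ_u ⊗ E)(u)‖ = w_u‖E‖`;
* §2 the band solved for the weight: `b₀·L^{j(d+1)+2(k−j)} ≤ w_u ≤ b₁·L^{j(d+1)+2(k−j)}` (`j = lev u`; `c_f = L^k` by `MemberY.hcfk`), hence
  `b₀·L^{k(d+1)} ≤ w_u` on top-level bonds (`inΛY_top`) — the unit-lattice weight in flat units is `a_k·η^{−(d+1)}`;
* §3 THE `𝒥`-ROW AT `U = 1`: `⟨D̃⁽²⁾·,J⟩(1) = 0` is the letters' clause `SectELettersY.D2J_one`, so at `U = 1` the row reads `w_u‖E‖ ≤ K_J‖E‖` at `u = v` and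
  `0 ≤ …` off the diagonal: ★★ `w_le_of_JRow_one` ∕ ★ `JRow_one_of_w_le` ∕ ★★ `JRow_one_iff` — the row's `U = 1` content is EXACTLY «`K_J ≥ max_u w_u`»;
* §4 ★★★ `b0_pow_top_le_KJ_of_JRow_one`: the row at `U = 1` and ONE bond of `Λ` force `θ.b₀·L^{k(d+1)} ≤ K_J`; ★★ `not_JRow_one_of_KJ_lt`: for
  `K_J < b₀·L^{k(d+1)}` the row FAILS at `U = 1` — so, `K_J` being bound before the member, every precision door is VACUOUS at `U = 1` for all members of
  level `k > log(K_J∕b₀)∕((d+1) log L)`: as typed the doors cannot deliver (3.24) uniformly in the renormalisation step `k`;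
* §5 at a general `U` the row forces the `J`-letter to cancel the weight: `(w_u − K_J)‖E‖ ≤ ‖⟨D̃⁽²⁾·,J⟩(U)(δ_u ⊗ E)(u)‖`;
* §6 the same at the fibre of record `M_N(ℂ)` (`E := 1`), for the letters of ANY record (`sectELettersYOfRecordTC`, `sectEYOfRecordV6`, the v8
  `sectEYWithDt2` — all `SectELettersY` instances);
* §7 THE REPAIR IS UNIFORM: with print's unit factor `λ_x := ((L^k)⁻¹)^{d+1} = η^{d+1}` (the token of def-Y's `etaDY x`, `Node00.OpsYSectEPrintUnits`)
  on the precision-type letter, `λ_x·‖a(δ_v ⊗ E)(u)‖ ≤ b₁‖E‖` for EVERY member (`1 ≤ d`), so at `U = 1` the RESCALED `𝒥`-row holds with `K_J := b₁`,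
  any rate `δ`, hypothesis-free (★★ `JRowPrint_one`).
Companion located by seat n08-b at the same hour (CLAIM-10, `…PrecisionDoorOnLambda`): restricting (R2′) to Λ-bonds removes the LEVEL dependence of the
weights; §4 shows the SCALE dependence `L^{k(d+1)}` survives on Λ-bonds, §7 that the unit factor removes it.

HONEST SCOPE.  Count-neutral finite bookkeeping over def-Y's certified letters (`aY`, `SectELettersY.D2J_one`), r06's band (`GlobalBand`) and the pin
geometry (`inΛY_top`, `unitDistY_self`); def-Y's convention word (v) is quoted, not re-derived for `(QG₁Q*)⁻¹` (the analogous statement for row (R2′a)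
and for the two-sided form rows `γ₀ ≤ T ≤ γ₁` of the covariance-currency doors follows from the same word and is NOT certified here).  NO door is
refuted — each is a correctly proved implication; what is proved is that its `𝒥`-row hypothesis is unsatisfiable at `U = 1` uniformly in `k`, and that
the print-unit rescaling repairs the `a`-part uniformly.  Nothing of [Balaban1985BackgroundPropagators] ∕ [BenfattoEtAl1978] ∕ [Balaban1985UV3] is
asserted; the IDENT is NOT made; `PrintedUV3V` ∕ row `h324c` NOT discharged; node N08 NOT discharged; one finite 𝕋^{d+1} programme — nothing about
d = 4 specifically, the continuum, OS axioms, a mass gap or the Clay problem.  No `sorry`, no `def`, no `instance`, no `notation`.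
-/

noncomputable section

namespace Literature.MathematicalPhysics.QuantumFieldTheory.Balaban1983to89.B1Eq324BenfattoClassSectEMemberJRowScaleAtNode00

open Literature.MathematicalPhysics.QuantumFieldTheory
open Literature.MathematicalPhysics.QuantumFieldTheory.Balaban1983to89.B9PinMembersKLevelV1 (MemberY)
open Literature.MathematicalPhysics.QuantumFieldTheory.Balaban1983to89.B9PinGeometryKLevelV1 (unitDistY unitDistY_nonneg inΛY inΛY_top)
open Literature.MathematicalPhysics.QuantumFieldTheory.Balaban1983to89.B6KLevelCensusIndexV1 (KIdx)
open Literature.MathematicalPhysics.QuantumFieldTheory.Balaban1983to89.B6Ineq2142KLevelV1 (lvl lvl_le)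
open Literature.MathematicalPhysics.QuantumFieldTheory.Balaban1983to89.B9Eq3104CommutatorSizesAvg (aY_apply)
open Literature.MathematicalPhysics.QuantumFieldTheory.Balaban1983to89.B9Thm314WholePinGeometry (unitDistY_self)
open Literature.MathematicalPhysics.QuantumFieldTheory.Balaban1983to89.Node00

variable {𝔸 : Type} [NormedRing 𝔸] [NormedAlgebra ℂ 𝔸] [CompleteSpace 𝔸]
variable {d ℓ : ℕ} {hd : 1 ≤ d + 1} {hL : Odd (ℓ + 1) ∧ 1 < ℓ + 1} {b₀ b₁ : ℝ} {Mstar : ℕ}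

/-! ## §1  The weight operator `a` on one-bond functions -/

section Weight

variable (i : KIdx d ℓ hd hL b₀ b₁)

omit [CompleteSpace 𝔸] in
/-- **`a` IS DIAGONAL ON ONE-BOND FUNCTIONS**: `a(δ_v ⊗ E)(u) = [u = v]·w_u·E` (n06's `aY_apply` over def-Y's `aK_eq_diagonal`).
[cite: Balaban1985BackgroundPropagators, (3.26) p.395 («Q*(U)aQ(U)»), (3.156) p.428 («a⟨B,B⟩»); Balaban1984PropagatorsII, (2.19) p.226, bookkeeping] -/
theorem aY_single [DecidableEq (IBondY i)] (v : IBondY i) (E : 𝔸) (u : IBondY i) :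
    aY (𝔸 := 𝔸) i (Pi.single v E) u = if u = v then ((i.w u : ℝ) : ℂ) • E else 0 := by
  rw [aY_apply, Pi.single_apply]
  split_ifs with h
  · rfl
  · rw [smul_zero]

omit [CompleteSpace 𝔸] in
/-- off the diagonal `a(δ_v ⊗ E)(u) = 0`. [cite: Balaban1985BackgroundPropagators, (3.26) p.395, bookkeeping] -/
theorem aY_single_of_ne [DecidableEq (IBondY i)] {u v : IBondY i} (h : u ≠ v) (E : 𝔸) : aY (𝔸 := 𝔸) i (Pi.single v E) u = 0 := by
  rw [aY_single, if_neg h]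

omit [CompleteSpace 𝔸] in
/-- ★ **THE DIAGONAL OF `a` IN NORM**: `‖a(δ_u ⊗ E)(u)‖ = w_u·‖E‖` (the weights are positive, `KIdx.hw`).
[cite: Balaban1985BackgroundPropagators, (3.26) p.395; Balaban1984PropagatorsII, (2.16) p.225, bookkeeping] -/
theorem norm_aY_single_self [DecidableEq (IBondY i)] (u : IBondY i) (E : 𝔸) : ‖aY (𝔸 := 𝔸) i (Pi.single u E) u‖ = i.w u * ‖E‖ := by
  rw [aY_single, if_pos rfl, norm_smul, Complex.norm_real, Real.norm_of_nonneg (i.hw u).le]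

end Weight

/-! ## §2  The band (2.16) solved for the weight: `b₀·L^{j(d+1)+2(k−j)} ≤ w ≤ b₁·L^{j(d+1)+2(k−j)}`, `b₀·L^{k(d+1)} ≤ w` on top-level bonds -/

section Band

variable (x : MemberY d ℓ hd hL b₀ b₁ Mstar)

/-- ★ **THE LOWER BAND, SOLVED FOR THE WEIGHT**: `b₀·L^{j(d+1)+2(k−j)} ≤ w_u` for an index bond `u` of level `j` (`GlobalBand`: `b₀(L^j)^{d+1} ≤
w_u∕(c_f∕L^j)²`, and `c_f = L^k` for a member, `MemberY.hcfk`). [cite: Balaban1984PropagatorsII, (2.16) p.225, (2.1) p.224 («η = L^{−k}»), bookkeeping] -/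
theorem b0_pow_le_w (u : IBondY x.toKIdx) :
    b₀ * (((ℓ + 1 : ℕ) : ℝ)) ^ (lvl x.hN x.D x.hk u * (d + 1) + (x.k - lvl x.hN x.D x.hk u) * 2) ≤ x.w u := by
  have hband := (x.hwb u).1
  have hL0 : (0 : ℝ) < ((ℓ + 1 : ℕ) : ℝ) := by positivity
  have hj : lvl x.hN x.D x.hk u ≤ x.k := lvl_le x.hN x.D x.hk u
  have hcf : x.cf / (((ℓ + 1 : ℕ) : ℝ)) ^ (u.1.1 : ℕ) = (((ℓ + 1 : ℕ) : ℝ)) ^ (x.k - lvl x.hN x.D x.hk u) := by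
    rw [x.hcfk]; exact (pow_sub₀ _ hL0.ne' hj).symm
  rw [hcf, le_div_iff₀ (by positivity)] at hband
  calc b₀ * (((ℓ + 1 : ℕ) : ℝ)) ^ (lvl x.hN x.D x.hk u * (d + 1) + (x.k - lvl x.hN x.D x.hk u) * 2)
      = b₀ * ((((ℓ + 1 : ℕ) : ℝ)) ^ (u.1.1 : ℕ)) ^ (d + 1) * ((((ℓ + 1 : ℕ) : ℝ)) ^ (x.k - lvl x.hN x.D x.hk u)) ^ 2 := by
        rw [pow_add, pow_mul, pow_mul, mul_assoc]
    _ ≤ x.w u := hband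

/-- ★ **THE UPPER BAND, SOLVED FOR THE WEIGHT**: `w_u ≤ b₁·L^{j(d+1)+2(k−j)}`. [cite: Balaban1984PropagatorsII, (2.16) p.225, (2.1) p.224, bookkeeping] -/
theorem w_le_b1_pow (u : IBondY x.toKIdx) :
    x.w u ≤ b₁ * (((ℓ + 1 : ℕ) : ℝ)) ^ (lvl x.hN x.D x.hk u * (d + 1) + (x.k - lvl x.hN x.D x.hk u) * 2) := by
  have hband := (x.hwb u).2
  have hL0 : (0 : ℝ) < ((ℓ + 1 : ℕ) : ℝ) := by positivity
  have hj : lvl x.hN x.D x.hk u ≤ x.k := lvl_le x.hN x.D x.hk u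
  have hcf : x.cf / (((ℓ + 1 : ℕ) : ℝ)) ^ (u.1.1 : ℕ) = (((ℓ + 1 : ℕ) : ℝ)) ^ (x.k - lvl x.hN x.D x.hk u) := by
    rw [x.hcfk]; exact (pow_sub₀ _ hL0.ne' hj).symm
  rw [hcf, div_le_iff₀ (by positivity)] at hband
  calc x.w u ≤ b₁ * ((((ℓ + 1 : ℕ) : ℝ)) ^ (u.1.1 : ℕ)) ^ (d + 1) * ((((ℓ + 1 : ℕ) : ℝ)) ^ (x.k - lvl x.hN x.D x.hk u)) ^ 2 := hband
    _ = b₁ * (((ℓ + 1 : ℕ) : ℝ)) ^ (lvl x.hN x.D x.hk u * (d + 1) + (x.k - lvl x.hN x.D x.hk u) * 2) := by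
        symm; rw [pow_add, pow_mul, pow_mul, mul_assoc]

/-- ★★ **ON A TOP-LEVEL BOND THE FLAT WEIGHT IS `a_k·η^{−(d+1)}`, LOWER SIDE**: `inΛY x u → b₀·L^{k(d+1)} ≤ w_u` (`inΛY_top`: bonds of `Λ` are of level
`k`; `L^{k(d+1)} = η^{−(d+1)}`). [cite: Balaban1984PropagatorsII, (2.16) p.225, (2.1) p.224; Balaban1985BackgroundPropagators, Thm 3.15 p.432 («Λ ⊂ Λ_k»)] -/
theorem b0_pow_top_le_w {u : IBondY x.toKIdx} (hu : inΛY x u) : b₀ * (((ℓ + 1 : ℕ) : ℝ)) ^ (x.k * (d + 1)) ≤ x.w u := by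
  have h := b0_pow_le_w x u
  rwa [inΛY_top hu, Nat.sub_self, zero_mul, add_zero] at h

/-- the same, UPPER side: `inΛY x u → w_u ≤ b₁·L^{k(d+1)}`. [cite: Balaban1984PropagatorsII, (2.16) p.225, (2.1) p.224, bookkeeping] -/
theorem w_top_le_b1_pow {u : IBondY x.toKIdx} (hu : inΛY x u) : x.w u ≤ b₁ * (((ℓ + 1 : ℕ) : ℝ)) ^ (x.k * (d + 1)) := by
  have h := w_le_b1_pow x u
  rwa [inΛY_top hu, Nat.sub_self, zero_mul, add_zero] at h

/-- the band exponent is at most the top one: `j(d+1) + 2(k−j) ≤ k(d+1)` for `j ≤ k`, `1 ≤ d`. [cite: Balaban1984PropagatorsII, (2.16) p.225, bookkeeping] -/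
theorem band_exp_le_top (hd1 : 1 ≤ d) (u : IBondY x.toKIdx) :
    lvl x.hN x.D x.hk u * (d + 1) + (x.k - lvl x.hN x.D x.hk u) * 2 ≤ x.k * (d + 1) := by
  have hj : lvl x.hN x.D x.hk u ≤ x.k := lvl_le x.hN x.D x.hk u
  have h2 : (x.k - lvl x.hN x.D x.hk u) * 2 ≤ (x.k - lvl x.hN x.D x.hk u) * (d + 1) := Nat.mul_le_mul_left _ (by omega)
  calc lvl x.hN x.D x.hk u * (d + 1) + (x.k - lvl x.hN x.D x.hk u) * 2
      ≤ lvl x.hN x.D x.hk u * (d + 1) + (x.k - lvl x.hN x.D x.hk u) * (d + 1) := Nat.add_le_add_left h2 _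
    _ = x.k * (d + 1) := by rw [← Nat.add_mul, Nat.add_sub_cancel' hj]

/-- ★ **EVERY flat weight is at most `b₁·L^{k(d+1)}`** (`1 ≤ d`, `0 ≤ b₁`): the uniform upper side used by the print-unit repair §7.
[cite: Balaban1984PropagatorsII, (2.16) p.225, (2.1) p.224, bookkeeping] -/
theorem w_le_b1_pow_top (hd1 : 1 ≤ d) (hb₁ : 0 ≤ b₁) (u : IBondY x.toKIdx) : x.w u ≤ b₁ * (((ℓ + 1 : ℕ) : ℝ)) ^ (x.k * (d + 1)) := by
  have hL1 : (1 : ℝ) ≤ ((ℓ + 1 : ℕ) : ℝ) := by exact_mod_cast Nat.succ_le_succ (Nat.zero_le ℓ)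
  exact (w_le_b1_pow x u).trans (mul_le_mul_of_nonneg_left (pow_le_pow_right₀ hL1 (band_exp_le_top x hd1 u)) hb₁)

end Band

/-! ## §3  The `𝒥`-row at `U = 1`: its content is exactly `K_J ≥ max_u w_u` -/

section RowOne

variable (x : MemberY d ℓ hd hL b₀ b₁ Mstar)

/-- **AT `U = 1` THE `𝒥`-OPERATOR IS `a`**: `a + ⟨D̃⁽²⁾·,J⟩(1) = a` (the letters' clause `SectELettersY.D2J_one`; at the v8 record a THEOREM of def-Y's
`d2JOfY_one`, `J(1) = 0`). [cite: Balaban1985BackgroundPropagators, (3.156) p.428, (3.117) p.419 («J … is small»), bookkeeping] -/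
theorem JOp_one (𝔢 : SectELettersY 𝔸 x) : aY x.toKIdx + 𝔢.D2J (fun _ _ => 1) = aY x.toKIdx := by
  rw [𝔢.D2J_one, add_zero]

/-- the row's left-hand side at `U = 1`, unfolded: `((a + ⟨D̃⁽²⁾·,J⟩(1))(δ_v ⊗ E))(u) = a(δ_v ⊗ E)(u)`. [cite: Balaban1985BackgroundPropagators, (3.156) p.428, bookkeeping] -/
theorem JRow_one_single [DecidableEq (IBondY x.toKIdx)] (𝔢 : SectELettersY 𝔸 x) (v : IBondY x.toKIdx) (E : 𝔸) (u : IBondY x.toKIdx) :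
    ((aY x.toKIdx + 𝔢.D2J (fun _ _ => 1)).restrictScalars ℝ) (Pi.single v E) u = aY (𝔸 := 𝔸) x.toKIdx (Pi.single v E) u := by
  rw [JOp_one, LinearMap.restrictScalars_apply]

/-- ★★ **THE `𝒥`-ROW AT `U = 1` FORCES `w_u ≤ K_J` FOR EVERY INDEX BOND** (test the row at `u = v` on any `E ≠ 0`; the distance of a bond to itself is
`0`, `unitDistY_self`).  The row is the doors' hypothesis `hJ` verbatim, at `U := 1`.
[cite: Balaban1985BackgroundPropagators, (3.156) p.428, (3.26) p.395; Balaban1984PropagatorsII, (2.16) p.225; BenfattoEtAl1978, Lemma (4.5)–(4.7) p.152 (class form)] -/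
theorem w_le_of_JRow_one [DecidableEq (IBondY x.toKIdx)] (𝔢 : SectELettersY 𝔸 x) {KJ δ : ℝ}
    (hJ : ∀ (u v : IBondY x.toKIdx) (E : 𝔸),
      ‖((aY x.toKIdx + 𝔢.D2J (fun _ _ => 1)).restrictScalars ℝ) (Pi.single v E) u‖ ≤ KJ * ‖E‖ * Real.exp (-(δ * unitDistY x u v)))
    {E : 𝔸} (hE : E ≠ 0) (u : IBondY x.toKIdx) : x.w u ≤ KJ := by
  have h := hJ u u E
  rw [JRow_one_single, norm_aY_single_self, unitDistY_self, mul_zero, neg_zero, Real.exp_zero, mul_one] at h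
  exact le_of_mul_le_mul_right h (norm_pos_iff.2 hE)

/-- ★ **CONVERSELY, `K_J ≥ max_u w_u` GIVES THE `𝒥`-ROW AT `U = 1`** (any `K_J ≥ 0`, any rate `δ`: off the diagonal the left-hand side vanishes).
[cite: Balaban1985BackgroundPropagators, (3.156) p.428, (3.26) p.395, bookkeeping] -/
theorem JRow_one_of_w_le [DecidableEq (IBondY x.toKIdx)] (𝔢 : SectELettersY 𝔸 x) {KJ : ℝ} (δ : ℝ) (hKJ : 0 ≤ KJ)
    (hw : ∀ u : IBondY x.toKIdx, x.w u ≤ KJ) (u v : IBondY x.toKIdx) (E : 𝔸) :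
    ‖((aY x.toKIdx + 𝔢.D2J (fun _ _ => 1)).restrictScalars ℝ) (Pi.single v E) u‖ ≤ KJ * ‖E‖ * Real.exp (-(δ * unitDistY x u v)) := by
  rw [JRow_one_single]
  by_cases huv : u = v
  · subst huv
    rw [norm_aY_single_self, unitDistY_self, mul_zero, neg_zero, Real.exp_zero, mul_one]
    exact mul_le_mul_of_nonneg_right (hw u) (norm_nonneg E)
  · rw [aY_single_of_ne _ huv, norm_zero]
    exact mul_nonneg (mul_nonneg hKJ (norm_nonneg E)) (Real.exp_pos _).le

/-- ★★ **THE `U = 1` CONTENT OF THE `𝒥`-ROW IS EXACTLY «`K_J ≥ max_u w_u`»** (nontrivial fibre; `K_J ≥ 0` as in the doors).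
[cite: Balaban1985BackgroundPropagators, (3.156) p.428, (3.26) p.395; Balaban1984PropagatorsII, (2.16) p.225, bookkeeping] -/
theorem JRow_one_iff [DecidableEq (IBondY x.toKIdx)] [Nontrivial 𝔸] (𝔢 : SectELettersY 𝔸 x) {KJ : ℝ} (δ : ℝ) (hKJ : 0 ≤ KJ) :
    (∀ (u v : IBondY x.toKIdx) (E : 𝔸),
        ‖((aY x.toKIdx + 𝔢.D2J (fun _ _ => 1)).restrictScalars ℝ) (Pi.single v E) u‖ ≤ KJ * ‖E‖ * Real.exp (-(δ * unitDistY x u v))) ↔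
      ∀ u : IBondY x.toKIdx, x.w u ≤ KJ := by
  obtain ⟨E, hE⟩ := exists_ne (0 : 𝔸)
  exact ⟨fun hJ u => w_le_of_JRow_one x 𝔢 hJ hE u, fun hw u v E' => JRow_one_of_w_le x 𝔢 δ hKJ hw u v E'⟩

end RowOne

/-! ## §4  Consequence: `K_J ≥ b₀·L^{k(d+1)}` — no member-uniform `K_J` serves the doors at `U = 1` -/

section Scale

variable (x : MemberY d ℓ hd hL b₀ b₁ Mstar)

/-- ★ **EVERY LEVEL**: the `𝒥`-row at `U = 1` forces `b₀·L^{j(d+1)+2(k−j)} ≤ K_J` at each index bond of level `j`.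
[cite: Balaban1985BackgroundPropagators, (3.156) p.428; Balaban1984PropagatorsII, (2.16) p.225, (2.1) p.224] -/
theorem b0_pow_le_KJ_of_JRow_one [DecidableEq (IBondY x.toKIdx)] (𝔢 : SectELettersY 𝔸 x) {KJ δ : ℝ}
    (hJ : ∀ (u v : IBondY x.toKIdx) (E : 𝔸),
      ‖((aY x.toKIdx + 𝔢.D2J (fun _ _ => 1)).restrictScalars ℝ) (Pi.single v E) u‖ ≤ KJ * ‖E‖ * Real.exp (-(δ * unitDistY x u v)))
    {E : 𝔸} (hE : E ≠ 0) (u : IBondY x.toKIdx) :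
    b₀ * (((ℓ + 1 : ℕ) : ℝ)) ^ (lvl x.hN x.D x.hk u * (d + 1) + (x.k - lvl x.hN x.D x.hk u) * 2) ≤ KJ :=
  (b0_pow_le_w x u).trans (w_le_of_JRow_one x 𝔢 hJ hE u)

/-- ★★★ **THE `𝒥`-ROW AT `U = 1` AND ONE BOND OF `Λ` FORCE `b₀·L^{k(d+1)} ≤ K_J`** — the flat unit-lattice weight is `a_k·η^{−(d+1)}` (def-Y's
convention word (v)), and the row bounds it by the class scalar.  Since the doors bind `K_J` BEFORE the member, they are vacuous at `U = 1` for every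
member with `L^{k(d+1)} > K_J∕b₀`. [cite: Balaban1985BackgroundPropagators, (3.156) p.428, Thm 3.15 p.432; Balaban1984PropagatorsII, (2.16) p.225, (2.1) p.224;
Balaban1985UV3, (24) p.262 (uniformity in k is the use made of (3.24))] -/
theorem b0_pow_top_le_KJ_of_JRow_one [DecidableEq (IBondY x.toKIdx)] (𝔢 : SectELettersY 𝔸 x) {KJ δ : ℝ}
    (hJ : ∀ (u v : IBondY x.toKIdx) (E : 𝔸),
      ‖((aY x.toKIdx + 𝔢.D2J (fun _ _ => 1)).restrictScalars ℝ) (Pi.single v E) u‖ ≤ KJ * ‖E‖ * Real.exp (-(δ * unitDistY x u v)))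
    {E : 𝔸} (hE : E ≠ 0) {u : IBondY x.toKIdx} (hu : inΛY x u) : b₀ * (((ℓ + 1 : ℕ) : ℝ)) ^ (x.k * (d + 1)) ≤ KJ :=
  (b0_pow_top_le_w x hu).trans (w_le_of_JRow_one x 𝔢 hJ hE u)

/-- ★★ **BELOW THE SCALE THE ROW FAILS**: for `K_J < b₀·L^{k(d+1)}` and a member with a bond in `Λ`, the `𝒥`-row is FALSE at `U = 1` (nontrivial fibre).
[cite: Balaban1985BackgroundPropagators, (3.156) p.428; Balaban1984PropagatorsII, (2.16) p.225, (2.1) p.224] -/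
theorem not_JRow_one_of_KJ_lt [DecidableEq (IBondY x.toKIdx)] [Nontrivial 𝔸] (𝔢 : SectELettersY 𝔸 x) {KJ : ℝ} (δ : ℝ)
    (hKJ : KJ < b₀ * (((ℓ + 1 : ℕ) : ℝ)) ^ (x.k * (d + 1))) {u : IBondY x.toKIdx} (hu : inΛY x u) :
    ¬ ∀ (u v : IBondY x.toKIdx) (E : 𝔸),
        ‖((aY x.toKIdx + 𝔢.D2J (fun _ _ => 1)).restrictScalars ℝ) (Pi.single v E) u‖ ≤ KJ * ‖E‖ * Real.exp (-(δ * unitDistY x u v)) := by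
  obtain ⟨E, hE⟩ := exists_ne (0 : 𝔸)
  exact fun hJ => not_lt.2 (b0_pow_top_le_KJ_of_JRow_one x 𝔢 hJ hE hu) hKJ

end Scale

/-! ## §5  At a general background the row forces the `J`-letter to cancel the weight -/

section RowU

variable (x : MemberY d ℓ hd hL b₀ b₁ Mstar)

/-- ★ **AT ANY `U` THE `𝒥`-ROW FORCES `‖⟨D̃⁽²⁾·,J⟩(U)(δ_u ⊗ E)(u)‖ ≥ (w_u − K_J)‖E‖`** (reverse triangle inequality on the diagonal): a `K_J` below the
flat weight can only be served by a `J`-letter whose diagonal cancels `a` — whereas print's `J`-term is SMALL ((3.117): *«the function J = D*η⁻²Im ∂U is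
small, if U satisfies the condition (3.36)»*) and vanishes at `U = 1`. [cite: Balaban1985BackgroundPropagators, (3.156) p.428, (3.117) p.419, (3.26) p.395] -/
theorem sub_mul_norm_le_norm_D2J_single_self [DecidableEq (IBondY x.toKIdx)] (𝔢 : SectELettersY 𝔸 x) (U : CfgY 𝔸 x.toKIdx) {KJ δ : ℝ}
    (hJ : ∀ (u v : IBondY x.toKIdx) (E : 𝔸),
      ‖((aY x.toKIdx + 𝔢.D2J U).restrictScalars ℝ) (Pi.single v E) u‖ ≤ KJ * ‖E‖ * Real.exp (-(δ * unitDistY x u v)))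
    (u : IBondY x.toKIdx) (E : 𝔸) : (x.w u - KJ) * ‖E‖ ≤ ‖𝔢.D2J U (Pi.single u E) u‖ := by
  have h := hJ u u E
  rw [unitDistY_self, mul_zero, neg_zero, Real.exp_zero, mul_one, LinearMap.restrictScalars_apply, LinearMap.add_apply,
    Pi.add_apply] at h
  have h2 : ‖aY (𝔸 := 𝔸) x.toKIdx (Pi.single u E) u‖ - ‖𝔢.D2J U (Pi.single u E) u‖ ≤ KJ * ‖E‖ :=
    (norm_sub_le_norm_add _ _).trans h
  rw [norm_aY_single_self] at h2
  linarith

/-- ★ on a bond of `Λ`: `(b₀·L^{k(d+1)} − K_J)‖E‖ ≤ ‖⟨D̃⁽²⁾·,J⟩(U)(δ_u ⊗ E)(u)‖`. [cite: Balaban1985BackgroundPropagators, (3.156) p.428, (3.117) p.419; Balaban1984PropagatorsII, (2.16) p.225] -/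
theorem b0_pow_sub_mul_le_norm_D2J_single_top [DecidableEq (IBondY x.toKIdx)] (𝔢 : SectELettersY 𝔸 x) (U : CfgY 𝔸 x.toKIdx) {KJ δ : ℝ}
    (hJ : ∀ (u v : IBondY x.toKIdx) (E : 𝔸),
      ‖((aY x.toKIdx + 𝔢.D2J U).restrictScalars ℝ) (Pi.single v E) u‖ ≤ KJ * ‖E‖ * Real.exp (-(δ * unitDistY x u v)))
    {u : IBondY x.toKIdx} (hu : inΛY x u) (E : 𝔸) :
    (b₀ * (((ℓ + 1 : ℕ) : ℝ)) ^ (x.k * (d + 1)) - KJ) * ‖E‖ ≤ ‖𝔢.D2J U (Pi.single u E) u‖ :=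
  (mul_le_mul_of_nonneg_right (sub_le_sub_right (b0_pow_top_le_w x hu) KJ) (norm_nonneg E)).trans
    (sub_mul_norm_le_norm_D2J_single_self x 𝔢 U hJ u E)

end RowU

/-! ## §6  At the fibre of record `M_N(ℂ)`: the doors of record (`…ofRecordTC`, `…sectEYOfRecordV6`, v8) at `U = 1` -/

section Record

open scoped Matrix.Norms.L2Operator

variable {N : ℕ} (θ : Stage3Params) {Mstar' : ℕ} (x : MemberY θ.d₆ θ.ℓ₆ θ.hd' θ.hL' θ.b₀ θ.b₁ Mstar')

/-- ★★★ **AT THE RECORD: THE `𝒥`-ROW OF ANY PRECISION DOOR AT `U = 1` AND ONE BOND OF `Λ` FORCE `θ.b₀·L^{k(d+1)} ≤ K_J`** — for the Sect. E letters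
`𝔢` of ANY record over the member (`sectELettersYOfRecordTC x 𝔳 𝔢₀`, `sectEYOfRecordV6 N θ M⋆ 𝔢₀ x`, the v8 `sectEYWithDt2 … x`: all carry `D2J_one`),
fibre `M_N(ℂ)`, tested on `E := 1`.  `θ.b₀ > 0` (`Stage3Params.hb`), so for each fixed `K_J` the row fails at `U = 1` from some level `k` on.
[cite: Balaban1985BackgroundPropagators, (3.156) p.428, Thm 3.15 p.432; Balaban1984PropagatorsII, (2.16) p.225, (2.1) p.224; Balaban1985UV3, (24) p.262] -/
theorem b0_pow_top_le_KJ_of_JRow_one_record [NeZero N] [DecidableEq (IBondY x.toKIdx)] (𝔢 : SectELettersY (Matrix (Fin N) (Fin N) ℂ) x) {KJ δ : ℝ}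
    (hJ : ∀ (u v : IBondY x.toKIdx) (E : Matrix (Fin N) (Fin N) ℂ),
      ‖((aY x.toKIdx + 𝔢.D2J (fun _ _ => 1)).restrictScalars ℝ) (Pi.single v E) u‖ ≤ KJ * ‖E‖ * Real.exp (-(δ * unitDistY x u v)))
    {u : IBondY x.toKIdx} (hu : inΛY x u) : θ.b₀ * (((θ.ℓ₆ + 1 : ℕ) : ℝ)) ^ (x.k * (θ.d₆ + 1)) ≤ KJ :=
  b0_pow_top_le_KJ_of_JRow_one x 𝔢 hJ (one_ne_zero (α := Matrix (Fin N) (Fin N) ℂ)) hu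

/-- ★★ **AT THE RECORD, BELOW THE SCALE THE ROW FAILS AT `U = 1`**: `K_J < θ.b₀·L^{k(d+1)}` and a bond of `Λ` ⇒ `¬ hJ(1)`.
[cite: Balaban1985BackgroundPropagators, (3.156) p.428; Balaban1984PropagatorsII, (2.16) p.225, (2.1) p.224] -/
theorem not_JRow_one_record_of_KJ_lt [NeZero N] [DecidableEq (IBondY x.toKIdx)] (𝔢 : SectELettersY (Matrix (Fin N) (Fin N) ℂ) x) {KJ : ℝ} (δ : ℝ)
    (hKJ : KJ < θ.b₀ * (((θ.ℓ₆ + 1 : ℕ) : ℝ)) ^ (x.k * (θ.d₆ + 1))) {u : IBondY x.toKIdx} (hu : inΛY x u) :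
    ¬ ∀ (u v : IBondY x.toKIdx) (E : Matrix (Fin N) (Fin N) ℂ),
        ‖((aY x.toKIdx + 𝔢.D2J (fun _ _ => 1)).restrictScalars ℝ) (Pi.single v E) u‖ ≤ KJ * ‖E‖ * Real.exp (-(δ * unitDistY x u v)) :=
  not_JRow_one_of_KJ_lt x 𝔢 δ hKJ hu

/-- ★ **THE MINIMAL ADMISSIBLE `K_J` AT `U = 1` LIES IN THE BAND `[θ.b₀, θ.b₁]·L^{k(d+1)}`** when the member has a bond in `Λ` (`2 ≤ D = d + 1`): the row
holds at `U = 1` with `K_J := θ.b₁·L^{k(d+1)}` (upper band, §2) and fails for every `K_J < θ.b₀·L^{k(d+1)}`.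
[cite: Balaban1985BackgroundPropagators, (3.156) p.428; Balaban1984PropagatorsII, (2.16) p.225, (2.1) p.224, bookkeeping] -/
theorem JRow_one_record_top [DecidableEq (IBondY x.toKIdx)] (hD : 2 ≤ θ.d₆ + 1) (𝔢 : SectELettersY (Matrix (Fin N) (Fin N) ℂ) x) (δ : ℝ)
    (u v : IBondY x.toKIdx) (E : Matrix (Fin N) (Fin N) ℂ) :
    ‖((aY x.toKIdx + 𝔢.D2J (fun _ _ => 1)).restrictScalars ℝ) (Pi.single v E) u‖ ≤
      θ.b₁ * (((θ.ℓ₆ + 1 : ℕ) : ℝ)) ^ (x.k * (θ.d₆ + 1)) * ‖E‖ * Real.exp (-(δ * unitDistY x u v)) := by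
  have hb₁ : 0 ≤ θ.b₁ := θ.hb.1.le.trans θ.hb.2
  exact JRow_one_of_w_le x 𝔢 δ (mul_nonneg hb₁ (pow_nonneg (by positivity) _)) (w_le_b1_pow_top x (by omega) hb₁) u v E

end Record

/-! ## §7  The print-unit rescaling `λ_x = (L^k)^{−(d+1)} = η^{d+1}` makes the `a`-part of the row UNIFORM in the member -/

section PrintUnits

variable (x : MemberY d ℓ hd hL b₀ b₁ Mstar)

/-- print's unit factor, the token `((L^k)⁻¹)^(d+1)` (def-Y's `etaDY x` of `Node00.OpsYSectEPrintUnits`, literally), equals `(L^{k(d+1)})⁻¹`.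
[cite: Balaban1984PropagatorsII, (2.1) p.224 («η = L^{−k}»), bookkeeping] -/
theorem inv_pow_pow_eq : ((((ℓ + 1 : ℕ) : ℝ)) ^ x.k)⁻¹ ^ (d + 1) = ((((ℓ + 1 : ℕ) : ℝ)) ^ (x.k * (d + 1)))⁻¹ := by
  rw [inv_pow, ← pow_mul]

/-- the unit factor is positive. [cite: Balaban1984PropagatorsII, (2.1) p.224, bookkeeping] -/
theorem inv_pow_pow_pos : (0 : ℝ) < ((((ℓ + 1 : ℕ) : ℝ)) ^ x.k)⁻¹ ^ (d + 1) := by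
  rw [inv_pow_pow_eq]; positivity

omit [CompleteSpace 𝔸] in
/-- ★★ **IN PRINT's UNITS THE DIAGONAL OF `a` IS UNIFORMLY BOUNDED**: `λ_x·‖a(δ_v ⊗ E)(u)‖ ≤ b₁‖E‖` with `λ_x := ((L^k)⁻¹)^{d+1}` for EVERY index bond of
EVERY member (`1 ≤ d`, `0 ≤ b₁`; the level-`j` value is `a_j·L^{(j−k)(d−1)} ≤ b₁`).  This is def-Y's word (v) read forwards: `η^{d+1}·aY` = print's `a`.
[cite: Balaban1985BackgroundPropagators, (3.26) p.395, (3.156) p.428; Balaban1984PropagatorsII, (2.16) p.225, (2.1) p.224] -/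
theorem etaD_mul_norm_aY_single_le [DecidableEq (IBondY x.toKIdx)] (hd1 : 1 ≤ d) (hb₁ : 0 ≤ b₁) (u v : IBondY x.toKIdx) (E : 𝔸) :
    ((((ℓ + 1 : ℕ) : ℝ)) ^ x.k)⁻¹ ^ (d + 1) * ‖aY (𝔸 := 𝔸) x.toKIdx (Pi.single v E) u‖ ≤ b₁ * ‖E‖ := by
  have hP : (0 : ℝ) < (((ℓ + 1 : ℕ) : ℝ)) ^ (x.k * (d + 1)) := by positivity
  rw [inv_pow_pow_eq]
  by_cases huv : u = v
  · subst huv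
    rw [norm_aY_single_self, inv_mul_le_iff₀ hP, ← mul_assoc, mul_comm _ b₁]
    exact mul_le_mul_of_nonneg_right (w_le_b1_pow_top x hd1 hb₁ u) (norm_nonneg E)
  · rw [aY_single_of_ne _ huv, norm_zero, mul_zero]
    exact mul_nonneg hb₁ (norm_nonneg E)

omit [CompleteSpace 𝔸] in
/-- the same with the unit factor as a complex scalar inside the norm: `‖(λ_x : ℂ)·a(δ_v ⊗ E)(u)‖ ≤ b₁‖E‖`. [cite: Balaban1985BackgroundPropagators, (3.26) p.395, (3.156) p.428; Balaban1984PropagatorsII, (2.16) p.225] -/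
theorem norm_etaD_smul_aY_single_le [DecidableEq (IBondY x.toKIdx)] (hd1 : 1 ≤ d) (hb₁ : 0 ≤ b₁) (u v : IBondY x.toKIdx) (E : 𝔸) :
    ‖((((((ℓ + 1 : ℕ) : ℝ)) ^ x.k)⁻¹ ^ (d + 1) : ℝ) : ℂ) • aY (𝔸 := 𝔸) x.toKIdx (Pi.single v E) u‖ ≤ b₁ * ‖E‖ := by
  rw [norm_smul, Complex.norm_real, Real.norm_of_nonneg (inv_pow_pow_pos x).le]
  exact etaD_mul_norm_aY_single_le x hd1 hb₁ u v E

/-- ★★ **THE RESCALED `𝒥`-ROW HOLDS AT `U = 1` WITH `K_J := b₁` FOR EVERY MEMBER** (any rate `δ`; `1 ≤ d`, `0 ≤ b₁`): with print's unit factor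
`λ_x = ((L^k)⁻¹)^{d+1}` on the precision-type letter `a + ⟨D̃⁽²⁾·,J⟩(U)` (def-Y's `deltaKPY`-currency), the row's `U = 1` instance is a THEOREM uniformly
in `k` — the repair of §4. [cite: Balaban1985BackgroundPropagators, (3.156) p.428, (3.26) p.395; Balaban1984PropagatorsII, (2.16) p.225, (2.1) p.224; BenfattoEtAl1978, Lemma (4.5)–(4.7) p.152 (class form)] -/
theorem JRowPrint_one [DecidableEq (IBondY x.toKIdx)] (hd1 : 1 ≤ d) (hb₁ : 0 ≤ b₁) (𝔢 : SectELettersY 𝔸 x) (δ : ℝ) (u v : IBondY x.toKIdx) (E : 𝔸) :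
    ‖(((((((ℓ + 1 : ℕ) : ℝ)) ^ x.k)⁻¹ ^ (d + 1) : ℝ) : ℂ) • (aY x.toKIdx + 𝔢.D2J (fun _ _ => 1))).restrictScalars ℝ (Pi.single v E) u‖ ≤
      b₁ * ‖E‖ * Real.exp (-(δ * unitDistY x u v)) := by
  rw [JOp_one, LinearMap.restrictScalars_apply, LinearMap.smul_apply, Pi.smul_apply]
  by_cases huv : u = v
  · subst huv
    rw [unitDistY_self, mul_zero, neg_zero, Real.exp_zero, mul_one]
    exact norm_etaD_smul_aY_single_le x hd1 hb₁ u u E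
  · rw [aY_single_of_ne _ huv, smul_zero, norm_zero]
    exact mul_nonneg (mul_nonneg hb₁ (norm_nonneg E)) (Real.exp_pos _).le

open scoped Matrix.Norms.L2Operator in
/-- ★★ **AT THE RECORD** (`θ.b₁ ≥ θ.b₀ > 0`, `2 ≤ D`): the rescaled `𝒥`-row of every door of record holds at `U = 1` with `K_J := θ.b₁`, every member.
[cite: Balaban1985BackgroundPropagators, (3.156) p.428, (3.26) p.395; Balaban1984PropagatorsII, (2.16) p.225, (2.1) p.224] -/
theorem JRowPrint_one_record {N : ℕ} (θ : Stage3Params) (hD : 2 ≤ θ.d₆ + 1) {Mstar' : ℕ} (x : MemberY θ.d₆ θ.ℓ₆ θ.hd' θ.hL' θ.b₀ θ.b₁ Mstar')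
    [DecidableEq (IBondY x.toKIdx)] (𝔢 : SectELettersY (Matrix (Fin N) (Fin N) ℂ) x) (δ : ℝ) (u v : IBondY x.toKIdx) (E : Matrix (Fin N) (Fin N) ℂ) :
    ‖(((((((θ.ℓ₆ + 1 : ℕ) : ℝ)) ^ x.k)⁻¹ ^ (θ.d₆ + 1) : ℝ) : ℂ) • (aY x.toKIdx + 𝔢.D2J (fun _ _ => 1))).restrictScalars ℝ (Pi.single v E) u‖ ≤
      θ.b₁ * ‖E‖ * Real.exp (-(δ * unitDistY x u v)) :=
  JRowPrint_one x (by omega) (θ.hb.1.le.trans θ.hb.2) 𝔢 δ u v E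

end PrintUnits

end Literature.MathematicalPhysics.QuantumFieldTheory.Balaban1983to89.B1Eq324BenfattoClassSectEMemberJRowScaleAtNode00
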